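import Literature.Computability.Cryptography.ChenQuantumLWEStepEight
import Literature.Computability.Cryptography.ChenQuantumLWENonDemolition

/-!
# Coarsening the line (`D ↦ gD`) does not change the deficit of Chen's Steps 8–9 (census row T6)

REPRODUCTION / ANALYSIS OF A CLAIMED RESULT UNDER ADJUDICATION (withdrawn): Yilei Chen, *Quantum
Algorithms for Lattice Problems*, IACR ePrint 2024/555, version of 2024-04-18 [ChenQuantumLattice2024]
(the version carrying the author's note that Step 9 contains a bug), Conditions C.1–C.3 (p. 18),
Claim 3.12 (p. 30), eq. (35) (p. 31), Lemma 3.13 / Claim 3.14 (pp. 32–34), §3.5.9 (pp. 34–38).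
Bundle `papers/QuantumAdvantage/lwe-quantum-autopsy/`, Part 2 (`REPAIR-CENSUS.md` §1 **T6**, rows A4 and
G3 of §3, §14.1 (α)); sequel of `ChenQuantumLWEStepEight.lean` (T7) and `ChenQuantumLWENonDemolition.lean`.
HONEST FRAMING: kernel-checked THEOREMS about the parameters and states of a WITHDRAWN algorithm — the
bookkeeping behind one row of a repair census (a precise negative result), NOT summit progress, no
cryptanalytic claim in either direction, no new algorithm; quantum lower bounds are out of scope.

## What is proved

The census row says: a variant of Steps 1–7 whose line superposition has step `x̃ = g·x = (gD)·b`
instead of `x = D·b` (e.g. one that pins a lattice coordinate modulo `gD` before the window measurement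
of Step 1) runs Steps 2–9 with `D̃ = gD` in place of `D`, and meets the SAME deficit: Step 8 certifies the
offset's first coordinate modulo `D̃²p₁`, Step 9 consumes it modulo `D̃²P`, `P = p₁Q`, and the missing
factor is `Q` for every `g`.  (Dictionary: the census writes `N` for this series' `P = p₁Q = M/(2D²)` and
`C` for this series' `Q`.)  Three groups of statements.

1. `LineParams` — the parameter bookkeeping of C.1–C.3, Claim 3.12 and eq. (35) over `ℚ`, with the
   scaling `D` a free parameter: `M = 2(t²+u²) = 2(c+1)D²‖b‖²` (`M_eq`, C.2), Chen's large modulus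
   `M(t²+u²) = M²/2` (`bigP_eq`, C.2), the period `M/(2D²) = (c+1)‖b‖²` of the line parameter `j`
   (`period_eq`, C.3: this is `p₁p₂⋯p_κ`), the chirp exponent `(2Dj)²/(2M) = j²/period` of eq. (35)
   (`chirp35_eq`) and Claim 3.12's coefficient `−(u²+t²)(2Dj)²/M² = −j²/period` (`chirp312_eq`).
   `D` CANCELS from the last three, so under `D ↦ gD` (`LineParams.coarsen`) the period and both chirp
   exponents are unchanged while `u²`, `M` scale by `g²` (`coarsen_period`, `coarsen_chirp35`,
   `coarsen_chirp312`, `coarsen_usq`, `coarsen_M`).  Step 7's renaming `v′ := k′x − v` (p. 31) makes the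
   pinned datum `v₀ mod D̃` a function of `v′₀ mod D̃` (`pinned_datum_of_offset`), which is part of the free
   line invariant `τ = v′₀ mod D̃²` (`toDsq_ptB_zero`, `isLineInvariant_toDsq` of
   `ChenQuantumLWENonDemolition`): pinning early buys nothing that `τ` did not already give.
2. `card_filter_castHom_mul` (folklore: the fibres of `ℤ_N → ℤ_m`, `m ∣ N`, all have `N/m` elements) and
   **`card_fibre_toStep8`**: for EVERY `D`, `p₁`, `Q`, every fibre of the Step-8 reduction
   `toStep8 : ℤ_{D²p₁Q} → ℤ_{D²p₁}` has exactly `Q` elements — given what Step 8 certifies about the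
   offset's first coordinate (Claim 3.14; `Shape.step8_ceiling_iff`: nothing finer is certified under
   eq. (12)), what Step 9 needs ranges over `Q` candidates, and `D` does not enter.
3. `Shape.coarsen g w` — Chen's Steps-8–9 shape with `D ↦ gD` and a new offset `w`: `P` is literally
   unchanged (`coarsen_P`), `N ↦ g²N`, `M ↦ g²M` (`coarsen_N`, `coarsen_M`); it is admissible when `g` is
   odd, coprime to `p₁` and `Q`, and `w ∈ gDℤⁿ⁺¹` (`Admissible.coarsen`), and CONVERSELY admissibility of
   any coarsened shape forces `gcd(g, P) = 1` (`coprime_of_coarsen_admissible`: a `g` sharing a prime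
   with `P` breaks C.3).  **`Shape.coarsen_deficit`**: the candidate count is `Q` for the shape and for
   every coarsening of it.  The `D`-uniform no-go theorems of the series then hold verbatim for the
   coarsened shape: the Step-8 ceiling sits at the same divisor of `P` (`coarsen_step8_ceiling_iff`,
   from `Shape.step8_ceiling_iff`), no non-demolition read-out of Step 8 supplies Step 9's datum
   (`coarsen_step8_cannot_supply_step9Needs`, from `Shape.step8_cannot_supply_step9Needs`), and the
   un-kicked Fourier sample is uniform with the same weight `P` (`coarsen_weight_qft_phi8b`, T3).

What is NOT formalised here (and nowhere in the series): Steps 1–7 themselves (Karst waves, complex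
Gaussian windows, the measurements producing eq. (35)); hence not the physical claim that a given
modification of Step 1 yields exactly the coarsened line — only the parameter identities C.1–C.3 /
Claim 3.12 / eq. (35) through which any such modification enters Steps 8–9, and the `D`-uniformity of
every Steps-8–9 statement.  Conditions and equations are quoted from the bundle's transcription
(`STEPS.md` §2–§3, printed page numbers; the e-print itself was not re-read in this generation).

References: [ChenQuantumLattice2024] Y. Chen, *Quantum Algorithms for Lattice Problems*, IACR ePrint
2024/555 (2024), withdrawn 2024-04-18, Cond. C.1–C.3 p. 18, Claim 3.12 p. 30, eq. (35) p. 31,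
Lemma 3.13 / Claim 3.14 pp. 32–34, §3.5.9 pp. 34–38.
-/

namespace Literature.Computability.Cryptography.Chen2024

open scoped BigOperators

/-! ### 1. The parameter bookkeeping of C.1–C.3, Claim 3.12, eq. (35): `D` cancels -/

/-- The three free quantities behind Chen's moduli in Steps 7–9: `‖b‖²` (`b` the short vector of
eq. (12)), the ratio `c = t²/u²` of Cond. C.1, and the scaling `D` (`x = D·b`, `u = ‖x‖`).
[cite: ChenQuantumLattice2024, Cond. C.1–C.3 p. 18, eq. (12) p. 17] -/
structure LineParams where
  /-- `‖b‖²` -/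
  bsq : ℚ
  /-- `c = t²/u²` (Cond. C.1) -/
  c : ℚ
  /-- the scaling factor `D` (`x = D·b`) -/
  D : ℚ

namespace LineParams

variable (L : LineParams)

/-- `u² = ‖x‖² = D²‖b‖²` (`x = D·b`). [cite: ChenQuantumLattice2024, Cond. C.2 p. 18] -/
def usq : ℚ := L.D ^ 2 * L.bsq

/-- `t² = c·u²` (Cond. C.1). [cite: ChenQuantumLattice2024, Cond. C.1 p. 18] -/
def tsq : ℚ := L.c * L.usq

/-- The small modulus `M = 2(t² + u²)` (Cond. C.2). [cite: ChenQuantumLattice2024, Cond. C.2 p. 18] -/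
def M : ℚ := 2 * (L.tsq + L.usq)

/-- Chen's LARGE modulus `M·(t² + u²)` (Cond. C.2; the paper's `P` — not the period `Shape.P = p₁Q` of
this series). [cite: ChenQuantumLattice2024, Cond. C.2 p. 18] -/
def bigP : ℚ := L.M * (L.tsq + L.usq)

/-- The period of the line parameter `j`: `M/(2D²)` (`= (c+1)‖b‖² = p₁p₂⋯p_κ` by Cond. C.3; the `P` of
`ChenQuantumLWESteps`). [cite: ChenQuantumLattice2024, Cond. C.3 p. 18] -/
def period : ℚ := L.M / (2 * L.D ^ 2)

/-- The chirp exponent of eq. (35): `(2Dj)²/(2M)` (the amplitude of `|φ7⟩` is `e(−(2Dj)²/(2M))·e(‖k‖²/4)`).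
[cite: ChenQuantumLattice2024, eq. (35) p. 31] -/
def chirp35 (j : ℚ) : ℚ := (2 * L.D * j) ^ 2 / (2 * L.M)

/-- Claim 3.12's coefficient of the quadratic phase in the line parameter: `−(u² + t²)·(2Dj)²/M²`.
[cite: ChenQuantumLattice2024, Claim 3.12 p. 30] -/
def chirp312 (j : ℚ) : ℚ := -(L.usq + L.tsq) * (2 * L.D * j) ^ 2 / L.M ^ 2

/-- COARSENING the line by `g`: the step becomes `x̃ = g·x = (gD)·b`, i.e. `D ↦ gD` with the same `b`
and the same `c`. [cite: ChenQuantumLattice2024, Cond. C.1–C.3 p. 18] -/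
def coarsen (g : ℚ) : LineParams := { L with D := g * L.D }

/-- C.2, second form: `M = 2(c+1)D²‖b‖²`. [cite: ChenQuantumLattice2024, Cond. C.2 p. 18] -/
theorem M_eq : L.M = 2 * (L.c + 1) * L.D ^ 2 * L.bsq := by
  simp only [M, tsq, usq]
  ring

/-- C.2, the large modulus: `M(t²+u²) = M²/2`. [cite: ChenQuantumLattice2024, Cond. C.2 p. 18] -/
theorem bigP_eq : L.bigP = L.M ^ 2 / 2 := by
  simp only [bigP, M]
  ring

/-- `M > 0` for `‖b‖² > 0`, `c ≥ 0`, `D ≠ 0`. [cite: ChenQuantumLattice2024, Cond. C.1–C.2 p. 18] -/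
theorem M_pos (hb : 0 < L.bsq) (hc : 0 ≤ L.c) (hD : L.D ≠ 0) : 0 < L.M := by
  rw [M_eq]
  have hD2 : 0 < L.D ^ 2 := by positivity
  have hc1 : 0 < L.c + 1 := by linarith
  positivity

/-- **C.3: the period is `D`-free.** `M/(2D²) = (c+1)‖b‖²`. [cite: ChenQuantumLattice2024, Cond. C.3 p. 18] -/
theorem period_eq (hD : L.D ≠ 0) : L.period = (L.c + 1) * L.bsq := by
  rw [period, M_eq, div_eq_iff (by positivity)]
  ring

/-- **eq. (35): the chirp exponent is `D`-free.** `(2Dj)²/(2M) = j²/(M/(2D²))` ("note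
`(2Dj)²/(2M) = j²/(p₁p′)`"). [cite: ChenQuantumLattice2024, eq. (35) p. 31] -/
theorem chirp35_eq (hD : L.D ≠ 0) (hM : L.M ≠ 0) (j : ℚ) : L.chirp35 j = j ^ 2 / L.period := by
  rw [chirp35, period]
  field_simp

/-- **Claim 3.12: the coefficient is `D`-free.** `−(u²+t²)(2Dj)²/M² = −j²/(M/(2D²))` (using C.2,
`u² + t² = M/2`). [cite: ChenQuantumLattice2024, Claim 3.12 p. 30, Cond. C.2 p. 18] -/
theorem chirp312_eq (hD : L.D ≠ 0) (hM : L.M ≠ 0) (j : ℚ) : L.chirp312 j = -(j ^ 2 / L.period) := by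
  have h : L.usq + L.tsq = L.M / 2 := by
    simp only [M]
    ring
  rw [chirp312, period, h]
  field_simp

section Coarsen

variable (g : ℚ)

/-- The coarsened scaling is `gD`. [cite: ChenQuantumLattice2024, Cond. C.3 p. 18] -/
@[simp] theorem coarsen_D : (L.coarsen g).D = g * L.D := rfl

/-- Coarsening keeps `‖b‖²`. [cite: ChenQuantumLattice2024, eq. (12) p. 17] -/
@[simp] theorem coarsen_bsq : (L.coarsen g).bsq = L.bsq := rfl

/-- Coarsening keeps `c` (Cond. C.1). [cite: ChenQuantumLattice2024, Cond. C.1 p. 18] -/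
@[simp] theorem coarsen_c : (L.coarsen g).c = L.c := rfl

/-- `ũ² = g²u²`. [cite: ChenQuantumLattice2024, Cond. C.2 p. 18] -/
theorem coarsen_usq : (L.coarsen g).usq = g ^ 2 * L.usq := by
  simp only [usq, coarsen_D, coarsen_bsq]
  ring

/-- `t̃² = g²t²` (same `c`). [cite: ChenQuantumLattice2024, Cond. C.1 p. 18] -/
theorem coarsen_tsq : (L.coarsen g).tsq = g ^ 2 * L.tsq := by
  simp only [tsq, coarsen_usq, coarsen_c]
  ring

/-- `M̃ = g²M` (C.2 for the coarsened line). [cite: ChenQuantumLattice2024, Cond. C.2 p. 18] -/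
theorem coarsen_M : (L.coarsen g).M = g ^ 2 * L.M := by
  simp only [M, coarsen_tsq, coarsen_usq]
  ring

/-- **T6, period.** The period `M̃/(2D̃²) = (c+1)‖b‖²` is the SAME after coarsening.
[cite: ChenQuantumLattice2024, Cond. C.3 p. 18] -/
theorem coarsen_period (hD : L.D ≠ 0) {g : ℚ} (hg : g ≠ 0) : (L.coarsen g).period = L.period := by
  rw [(L.coarsen g).period_eq (mul_ne_zero hg hD), L.period_eq hD]
  rfl

/-- **T6, chirp (eq. (35) form).** The chirp exponent is the SAME after coarsening.
[cite: ChenQuantumLattice2024, eq. (35) p. 31] -/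
theorem coarsen_chirp35 (hD : L.D ≠ 0) (hM : L.M ≠ 0) {g : ℚ} (hg : g ≠ 0) (j : ℚ) :
    (L.coarsen g).chirp35 j = L.chirp35 j := by
  have hM' : (L.coarsen g).M ≠ 0 := by
    rw [coarsen_M]
    exact mul_ne_zero (pow_ne_zero 2 hg) hM
  rw [(L.coarsen g).chirp35_eq (mul_ne_zero hg hD) hM', L.chirp35_eq hD hM, L.coarsen_period hD hg]

/-- **T6, chirp (Claim 3.12 form).** Claim 3.12's coefficient is the SAME after coarsening.
[cite: ChenQuantumLattice2024, Claim 3.12 p. 30] -/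
theorem coarsen_chirp312 (hD : L.D ≠ 0) (hM : L.M ≠ 0) {g : ℚ} (hg : g ≠ 0) (j : ℚ) :
    (L.coarsen g).chirp312 j = L.chirp312 j := by
  have hM' : (L.coarsen g).M ≠ 0 := by
    rw [coarsen_M]
    exact mul_ne_zero (pow_ne_zero 2 hg) hM
  rw [(L.coarsen g).chirp312_eq (mul_ne_zero hg hD) hM', L.chirp312_eq hD hM, L.coarsen_period hD hg]

end Coarsen

end LineParams

/-- **The pinned datum is a function of the offset's first coordinate modulo `D̃`.** Step 7 renames the
offset `v′ := k′x − v` (p. 31); with `x₀ = D̃·b₀ = −D̃` (`b₀ = −1`, eq. (12)) this reads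
`v′₀ = k′·(−D̃) − v₀`, so `v₀ ≡ −v′₀ (mod D̃)`: what an early pinning of the first lattice coordinate
modulo `D̃ = gD` reveals is determined by `v′₀ mod D̃`, hence by the free line invariant
`τ = v′₀ mod D̃²` (`toDsq_ptB_zero`, `isLineInvariant_toDsq`).
[cite: ChenQuantumLattice2024, eq. (35) p. 31 (renaming `v′ = k′x − v`), eq. (12) p. 17] -/
theorem pinned_datum_of_offset (Dt k' v₀ : ℤ) : v₀ ≡ -(k' * -Dt - v₀) [ZMOD Dt] :=
  Int.modEq_iff_dvd.2 ⟨k', by ring⟩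

/-! ### 2. The deficit count, uniformly in `D` -/

open Finset in
/-- Fibres of the reduction `ℤ_N → ℤ_m` (`m ∣ N`) all have `N/m` elements: `#{z : z mod m = y}·m = N`.
[folklore] -/
theorem card_filter_castHom_mul {N m : ℕ} [NeZero N] [NeZero m] (h : m ∣ N) (y : ZMod m) :
    (univ.filter fun z : ZMod N => ZMod.castHom h (ZMod m) z = y).card * m = N := by
  classical
  have hs := ZMod.castHom_surjective h
  have hfib : ∀ y' : ZMod m, (univ.filter fun z : ZMod N => ZMod.castHom h (ZMod m) z = y').card
      = (univ.filter fun z : ZMod N => ZMod.castHom h (ZMod m) z = y).card :=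
    fun y' => AddMonoidHom.card_fiber_eq_of_mem_range (ZMod.castHom h (ZMod m)) (hs y') (hs y)
  have htot := Finset.card_eq_sum_card_fiberwise (f := ZMod.castHom h (ZMod m))
    (s := (univ : Finset (ZMod N))) (t := (univ : Finset (ZMod m))) (fun _ _ => Finset.mem_univ _)
  rw [Finset.card_univ, ZMod.card] at htot
  calc (univ.filter fun z : ZMod N => ZMod.castHom h (ZMod m) z = y).card * m
      = ∑ y' : ZMod m, (univ.filter fun z : ZMod N => ZMod.castHom h (ZMod m) z = y').card := by
        rw [Finset.sum_congr rfl fun y' _ => hfib y', Finset.sum_const, Finset.card_univ, ZMod.card,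
          smul_eq_mul, mul_comm]
    _ = N := htot.symm

section Deficit

variable (D p₁ Q : ℕ+)

/-- **The deficit is `Q`, for every `D`.**  Every fibre of the Step-8 reduction
`toStep8 : ℤ_N → ℤ_{D²p₁}` (`N = D²p₁Q`) has exactly `Q` elements: given the Step-8 datum of the offset's
first coordinate (`v′₀ mod D²p₁`, Claim 3.14 — and by `Shape.step8_ceiling_iff` nothing finer is
certified under eq. (12)), the residue Step 9 needs (`v′₀ mod D²P`, §3.5 p. 22 / §3.5.9 p. 37) ranges
over `Q` candidates.  `D` does not enter the count.
[cite: ChenQuantumLattice2024, Claim 3.14 pp. 33–34, §3.5.9 p. 37] -/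
theorem card_fibre_toStep8 (y : ZMod ((D * D * p₁ : ℕ+) : ℕ)) :
    (Finset.univ.filter fun z : ZN D p₁ Q => toStep8 D p₁ Q z = y).card = Q := by
  have h := card_filter_castHom_mul (Dsqp₁_dvd_N D p₁ Q) y
  have hN : ((D * D * (p₁ * Q) : ℕ+) : ℕ) = (Q : ℕ) * ((D * D * p₁ : ℕ+) : ℕ) := by
    simp only [PNat.mul_coe]
    ring
  unfold toStep8
  exact Nat.eq_of_mul_eq_mul_right (PNat.pos _) (h.trans hN)

end Deficit

/-! ### 3. Chen's shape, coarsened -/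

namespace Shape

variable (S : Shape)

/-- COARSENING Chen's Steps-8–9 shape by `g`: the scaling `D ↦ gD` (line step `x̃ = (gD)·b`) with a new
offset `w` (the coarsened run's `v′ = k′x̃ − v`, eq. (35)); `n, p₁, Q, b, b*, v*` unchanged.
[cite: ChenQuantumLattice2024, Cond. C.3 p. 18, eq. (35) p. 31] -/
def coarsen (g : ℕ+) (w : Fin (S.n + 1) → ℤ) : Shape := { S with D := g * S.D, v' := w }

section Basic

variable (g : ℕ+) (w : Fin (S.n + 1) → ℤ)

/-- Coarsening keeps the dimension. [cite: ChenQuantumLattice2024, Cond. C.3 p. 18] -/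
@[simp] theorem coarsen_n : (S.coarsen g w).n = S.n := rfl

/-- The coarsened scaling is `D̃ = gD`. [cite: ChenQuantumLattice2024, Cond. C.3 p. 18] -/
@[simp] theorem coarsen_D : (S.coarsen g w).D = g * S.D := rfl

/-- Coarsening keeps `p₁`. [cite: ChenQuantumLattice2024, Cond. C.3 p. 18] -/
@[simp] theorem coarsen_p₁ : (S.coarsen g w).p₁ = S.p₁ := rfl

/-- Coarsening keeps `Q = p₂⋯p_κ`. [cite: ChenQuantumLattice2024, Cond. C.3 p. 18] -/
@[simp] theorem coarsen_Q : (S.coarsen g w).Q = S.Q := rfl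

/-- Coarsening keeps the short vector `b` of eq. (12). [cite: ChenQuantumLattice2024, eq. (12) p. 17] -/
@[simp] theorem coarsen_b : (S.coarsen g w).b = S.b := rfl

/-- The coarsened run's offset is `w`. [cite: ChenQuantumLattice2024, eq. (35) p. 31] -/
@[simp] theorem coarsen_v' : (S.coarsen g w).v' = w := rfl

/-- Coarsening keeps `b*` (Step-9 data). [cite: ChenQuantumLattice2024, eq. (39) p. 36] -/
@[simp] theorem coarsen_bstar : (S.coarsen g w).bstar = S.bstar := rfl

/-- Coarsening keeps `v*` (Step-9 data). [cite: ChenQuantumLattice2024, eq. (39) p. 36] -/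
@[simp] theorem coarsen_vstar : (S.coarsen g w).vstar = S.vstar := rfl

/-- **T6, period.** `P = p₁Q = M/(2D²)` is untouched by coarsening (cf. `LineParams.coarsen_period`).
[cite: ChenQuantumLattice2024, Cond. C.3 p. 18] -/
@[simp] theorem coarsen_P : (S.coarsen g w).P = S.P := rfl

/-- `Ñ = D̃²P = g²N`. [cite: ChenQuantumLattice2024, Cond. C.3 p. 18] -/
theorem coarsen_N : ((S.coarsen g w).N : ℕ) = (g : ℕ) ^ 2 * S.N := by
  simp only [N, coarsen_D, coarsen_P, PNat.mul_coe]
  ring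

/-- `M̃ = 2Ñ = g²M` (cf. `LineParams.coarsen_M`). [cite: ChenQuantumLattice2024, Cond. C.2–C.3 p. 18] -/
theorem coarsen_M : ((S.coarsen g w).M : ℕ) = (g : ℕ) ^ 2 * S.M := by
  simp only [M, PNat.mul_coe, coarsen_N]
  ring

/-- The chirped line of the coarsened shape is `|φ_{b,w}⟩` over `ℤ_{Ñ}` with the SAME phase law
`ψ_P(−j²)`, `j ∈ ℤ_P` (cf. `LineParams.coarsen_chirp35`). [cite: ChenQuantumLattice2024, §3.5.9 p. 35] -/
theorem coarsen_phi8b : (S.coarsen g w).phi8b = phi8bKet S.n (g * S.D) S.p₁ S.Q S.b w :=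
  (S.coarsen g w).phi8b_eq_phi8bKet

end Basic

/-- Admissibility (Cond. C.3, eq. (12), eq. (39)) transfers to the coarsened shape when `g` is odd,
coprime to `p₁` and to `Q`, and the new offset lies in `gD·ℤⁿ⁺¹`.
[cite: ChenQuantumLattice2024, Cond. C.3 p. 18, eq. (35) p. 31] -/
theorem Admissible.coarsen {S : Shape} (h : S.Admissible) {g : ℕ+} (hg : Odd (g : ℕ))
    (hgp : Nat.Coprime g S.p₁) (hgQ : Nat.Coprime g S.Q) {w : Fin (S.n + 1) → ℤ}
    (hw : ∀ i, ((g : ℕ) : ℤ) * S.D ∣ w i) : (S.coarsen g w).Admissible where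
  odd_D := by
    rw [coarsen_D, PNat.mul_coe]
    exact hg.mul h.odd_D
  odd_p₁ := h.odd_p₁
  odd_Q := h.odd_Q
  cop_Dp := by
    rw [coarsen_D, PNat.mul_coe]
    exact Nat.Coprime.mul_left hgp h.cop_Dp
  cop_DQ := by
    rw [coarsen_D, PNat.mul_coe]
    exact Nat.Coprime.mul_left hgQ h.cop_DQ
  cop_pQ := h.cop_pQ
  three_le_p₁ := h.three_le_p₁
  three_le_Q := h.three_le_Q
  Q_mod := h.Q_mod
  b_head := h.b_head
  b_tail := h.b_tail
  v'_in_DZ := fun i => by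
    rw [coarsen_D, coarsen_v', PNat.mul_coe, Nat.cast_mul]
    exact hw i
  bstar_head := h.bstar_head
  bstar_tail := h.bstar_tail
  vstar_head := h.vstar_head

/-- **Conversely, `g` must be coprime to `P`.**  If a coarsened shape is admissible (Cond. C.3 for
`D̃ = gD`: `D̃, p₁, …, p_κ` pairwise coprime) then `gcd(g, P) = 1`: a coarsening factor sharing a prime
with `P = p₁Q` breaks C.3 (and with it the invertibility of `2D̃²` modulo `P` on which the kick of §3.5
relies, `Admissible.isUnit_twoDD`). [cite: ChenQuantumLattice2024, Cond. C.3 p. 18] -/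
theorem coprime_of_coarsen_admissible {g : ℕ+} {w : Fin (S.n + 1) → ℤ}
    (h : (S.coarsen g w).Admissible) : Nat.Coprime g S.P := by
  have hp : Nat.Coprime ((g : ℕ) * S.D) S.p₁ := by
    simpa only [coarsen_D, coarsen_p₁, PNat.mul_coe] using h.cop_Dp
  have hQ : Nat.Coprime ((g : ℕ) * S.D) S.Q := by
    simpa only [coarsen_D, coarsen_Q, PNat.mul_coe] using h.cop_DQ
  rw [P, PNat.mul_coe]
  exact Nat.Coprime.mul_right hp.coprime_mul_right hQ.coprime_mul_right

/-- **T6: the deficit is `Q` before and after coarsening.**  For Chen's shape, and for EVERY coarsening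
`D ↦ gD` with ANY new offset `w`, the candidates for what Step 9 needs — the offset's first coordinate
modulo `N = D²P` (resp. `Ñ = D̃²P`) — that are consistent with what Step 8 certifies — it modulo `D²p₁`
(resp. `D̃²p₁`; Claim 3.14, and `step8_ceiling_iff`: all that Step 8 can certify under eq. (12)) —
number exactly `Q = P/p₁ ≥ 3` in both cases: coarsening multiplies both moduli by `g²` and leaves the
quotient where it was ("needed `g²D²P` vs known `g²D²p₁` — the same `Q`").
[cite: ChenQuantumLattice2024, Claim 3.14 pp. 33–34, §3.5 p. 22, §3.5.9 p. 37] -/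
theorem coarsen_deficit (g : ℕ+) (w : Fin (S.n + 1) → ℤ) :
    (Finset.univ.filter fun z : ZN S.D S.p₁ S.Q =>
        toStep8 S.D S.p₁ S.Q z = toStep8 S.D S.p₁ S.Q ((S.v' 0 : ℤ) : ZN S.D S.p₁ S.Q)).card = S.Q ∧
    (Finset.univ.filter fun z : ZN (S.coarsen g w).D S.p₁ S.Q =>
        toStep8 (S.coarsen g w).D S.p₁ S.Q z
          = toStep8 (S.coarsen g w).D S.p₁ S.Q ((w 0 : ℤ) : ZN (S.coarsen g w).D S.p₁ S.Q)).card = S.Q :=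
  ⟨card_fibre_toStep8 S.D S.p₁ S.Q _, card_fibre_toStep8 (S.coarsen g w).D S.p₁ S.Q _⟩

/-! ### The `D`-uniform no-go theorems, instantiated for the coarsened shape -/

section NoGo

variable {S}

/-- **Same Step-8 ceiling.**  For every divisor `g′` of `P`: measuring `|φ7.d⟩` of the COARSENED shape
certifies the head residue modulo `D̃·g′` iff measuring `|φ7.d⟩` of the original shape certifies it
modulo `D·g′` — both iff `g′` divides every `b_i (i ≠ 0)` (`step8_ceiling_iff`; `b` is unchanged by
coarsening).  Under eq. (12) alone the ceiling is `g′ = p₁` in both cases.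
[cite: ChenQuantumLattice2024, Claim 3.14 p. 33, eq. (12) p. 17] -/
theorem coarsen_step8_ceiling_iff (h : S.Admissible) {g : ℕ+} (hg : Odd (g : ℕ))
    (hgp : Nat.Coprime g S.p₁) (hgQ : Nat.Coprime g S.Q) {w : Fin (S.n + 1) → ℤ}
    (hw : ∀ i, ((g : ℕ) : ℤ) * S.D ∣ w i) {g' : ℕ} (hg' : g' ∣ (S.P : ℕ)) :
    (∀ u, (S.coarsen g w).phi7d u ≠ 0 →
        (((u 0).val : ℤ) : ZMod (((S.coarsen g w).D : ℕ) * g'))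
          = ((w 0 / (S.coarsen g w).D : ℤ) : ZMod (((S.coarsen g w).D : ℕ) * g')))
      ↔ ∀ u, S.phi7d u ≠ 0 →
        (((u 0).val : ℤ) : ZMod ((S.D : ℕ) * g')) = ((S.v' 0 / S.D : ℤ) : ZMod ((S.D : ℕ) * g')) := by
  exact ((S.coarsen g w).step8_ceiling_iff (h.coarsen hg hgp hgQ hw) hg').trans
    (S.step8_ceiling_iff h hg').symm

/-- **Same T7.**  For the coarsened shape too (`n ≥ 1`), every non-demolition read-out of Step 8 takes
the same sure value on an admissible instance with the same `b`, the same Step-8 output and a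
DIFFERENT Step-9 datum: Step 8 of the coarsened run cannot supply what its Step 9 consumes
(`step8_cannot_supply_step9Needs`, uniform in `D`).
[cite: ChenQuantumLattice2024, Lemma 3.13 p. 32, §3.5.9 p. 37] -/
theorem coarsen_step8_cannot_supply_step9Needs (h : S.Admissible) (hn : 0 < S.n) {g : ℕ+}
    (hg : Odd (g : ℕ)) (hgp : Nat.Coprime g S.p₁) (hgQ : Nat.Coprime g S.Q)
    {w : Fin (S.n + 1) → ℤ} (hw : ∀ i, ((g : ℕ) : ℤ) * S.D ∣ w i) {α : Type*}
    {F : (Fin (S.n + 1) → ZMod (S.coarsen g w).M) → α} (hF : (S.coarsen g w).NonDemolition F) :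
    ∃ v₃ : Fin (S.n + 1) → ℤ, ((S.coarsen g w).inst S.b v₃).Admissible
      ∧ ((S.coarsen g w).inst S.b v₃).step8Output = (S.coarsen g w).step8Output
      ∧ ((S.coarsen g w).inst S.b v₃).step9Needs ≠ (S.coarsen g w).step9Needs
      ∧ ∀ u u' : Fin (S.n + 1) → ZMod (S.coarsen g w).M, (S.coarsen g w).phi7d u ≠ 0 →
          ((S.coarsen g w).inst S.b v₃).phi7d u' ≠ 0 → F u = F u' :=
  (S.coarsen g w).step8_cannot_supply_step9Needs (h.coarsen hg hgp hgQ hw) hn hF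

/-- **Same T3.**  The un-kicked Fourier sample of the coarsened shape's `|φ8.b⟩` is uniform with the SAME
weight `P` on every outcome (`weight_qft_phi8b`, uniform in `D`).
[cite: ChenQuantumLattice2024, §3.5.9 p. 35] -/
theorem coarsen_weight_qft_phi8b (h : S.Admissible) {g : ℕ+} (hg : Odd (g : ℕ))
    (hgp : Nat.Coprime g S.p₁) (hgQ : Nat.Coprime g S.Q) {w : Fin (S.n + 1) → ℤ}
    (hw : ∀ i, ((g : ℕ) : ℤ) * S.D ∣ w i) (u : Fin (S.n + 1) → ZMod (S.coarsen g w).N) :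
    weight (qft (S.coarsen g w).phi8b) u = (S.P : ℕ) :=
  (S.coarsen g w).weight_qft_phi8b (h.coarsen hg hgp hgQ hw) u

end NoGo

end Shape

end Literature.Computability.Cryptography.Chen2024
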